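import Summits.ResolutionOfSingularities.ResolutionOfSingularities.Theorems.PurelyInseparableDim4Target
import Literature.AlgebraicGeometry.Resolution.CentreBlowupOrdAlongBasics
import Literature.AlgebraicGeometry.Resolution.CentreBlowupMohStability
import Literature.AlgebraicGeometry.Resolution.OrdZeroBasics
import Mathlib.Algebra.MvPolynomial.PDeriv
import Mathlib.FieldTheory.Finite.GaloisField
import HarnessLib

/-!
# Zoo certificates ‖ K for the census cell «res-dim4-pi» — row J-001 (the irrational kangaroo of P-2-1)

[OURS · census instrument · counted 0.]  Second file of the TY-4 series (`PurelyInseparableDim4ZooCert`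
holds J-003); the kernel replay of `boards/JUMPS.md` row **J-001** (K = B: eng-A ∧ eng-B ∧ idea-2 ∧
crit-1 by hand; KNOWN-INSTANCE of Hauser–Perlega 2019 Thm 1 with `b = 4` lost components), stated
against the cell's target frame (`PIDim4.Step0`, `RiseD`).  It turns a logged edge into a theorem
about OUR model (`CentreBlowup.step`) and says nothing about resolution of singularities, which is
NOT proved in dim ≥ 4 / char p anywhere in this programme.

## Row J-001.  Variables `(x, y, v, w) = Fin 4`, `p = q = 2`.

The presented state `a = (F = xyvw·(y² + v² + w²), r = (1,1,1,1), exc = all)` (shade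
`d = 6 − 4 = 2`, `G = (y + v + w)²`) is blown up in the POINT (MODE 0 edge; `ord₀ F = 6 ≥ 2`).  In the
`x`-chart the transform is `x⁴·yvw·(y² + v² + w²)`; at a point `(y, v, w) = (1, ω, ω²)` with
`ω² + ω + 1 = 0` — a primitive cube root of unity, which exists in `𝔽₄` but NOT in `𝔽₂` — the
translated polynomial is `x⁴(y+1)(v+ω)(w+ω²)·((y+1)² + (v+ω)² + (w+ω²)²)
= x⁴(y+1)(v+ω)(w+ω²)·(y² + v² + w²)` because `1 + ω² + ω⁴ = 0`; cleaning deletes exactly the three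
squares `x⁴y², x⁴v², x⁴w²` (the constant term `ω³ = 1` of the cubic factor), all three old components
are lost (`b_y, b_v, b_w ≠ 0`) and the new one gets multiplicity `6 − 2 = 4`, so the new residual
order is `≥ 4 + 1 + 2 = 7` and the shade is `≥ 7 − 4 = 3 > 2`: **RISE:d 2 → 3 at an `𝔽₄`-point, all
four components lost** (J-001 letter for letter; at the 15 `𝔽₂`-rational points there is no rise —
not certified here).  The new residual is non-zero because its `∂/∂w` equals that of the uncleaned
transform (deleting squares does not change derivatives in characteristic 2), whose value at
`(x,y,v,w) = (1,0,1,0)` is `1 + ω ≠ 0`.  The statement is proved for EVERY field of characteristic 2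
containing such an `ω` and then instantiated in `GaloisField 2 2`.
-/

-- house layout `Summits/<Summit>/<Problem>` doubles the namespace component (as in the Target file)
set_option linter.dupNamespace false

noncomputable section

namespace Summit.ResolutionOfSingularities.ResolutionOfSingularities.Theorems.PIDim4

namespace ZooCert

namespace J001

open MvPolynomial Finset
open Literature.AlgebraicGeometry.Resolution
open Literature.AlgebraicGeometry.Resolution.Hauser2010
open Literature.AlgebraicGeometry.Resolution.CentreBlowup

section AnyField

variable {K : Type} [Field K]

/-! ### generic helpers -/

/-- A monomial with unit coefficient in four variables as a product of powers. [folklore] -/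
theorem monomial_eq_prod (d : Fin 4 →₀ ℕ) :
    (monomial d (1 : K) : MvPolynomial (Fin 4) K) = X 0 ^ d 0 * X 1 ^ d 1 * X 2 ^ d 2 * X 3 ^ d 3 := by
  rw [MvPolynomial.monomial_eq, C_1, one_mul, Finsupp.prod_fintype _ _ (fun i => pow_zero _),
    Fin.prod_univ_four]

/-- Deleting `p`-th power monomials cannot lower the order at the origin. [folklore] -/
theorem le_ordZero_deletePthPowers (p : ℕ) (P : MvPolynomial (Fin 4) K) :
    ordZero P ≤ ordZero (deletePthPowers p P) := by
  classical
  rcases eq_or_ne P 0 with rfl | hP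
  · rw [deletePthPowers_zero]
  obtain ⟨n, hn⟩ := exists_ordZero_eq_natCast hP
  rw [hn, natCast_le_ordZero_iff_forall_coeff]
  intro d hd
  rw [coeff_deletePthPowers]
  split_ifs
  · rfl
  · exact coeff_eq_zero_of_degree_lt_ordZero (by rw [hn]; exact_mod_cast hd)

/-- In characteristic `p`, deleting the `p`-th power monomials does not change any partial
derivative: `∂ᵢ` kills every monomial whose `i`-th exponent is divisible by `p`. [folklore] -/
theorem pderiv_deletePthPowers (p : ℕ) [CharP K p] (i : Fin 4) (P : MvPolynomial (Fin 4) K) :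
    pderiv i (deletePthPowers p P) = pderiv i P := by
  classical
  ext m
  rw [coeff_pderiv, coeff_pderiv, coeff_deletePthPowers]
  split_ifs with h
  · have hdiv : p ∣ m i + 1 := by
      have := (isPthPowerExponent_iff p _).mp h i
      simpa [Finsupp.single_apply] using this
    rw [show ((m i : K) + 1) = ((m i + 1 : ℕ) : K) by push_cast; ring, (CharP.cast_eq_zero_iff K p _).mpr hdiv,
      mul_zero, mul_zero]
  · rfl

/-! ### the data of row J-001 -/

/-- exponent of `xy³vw`. [folklore] -/ def e1 : Fin 4 →₀ ℕ := Finsupp.equivFunOnFinite.symm ![1, 3, 1, 1]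
/-- exponent of `xyv³w`. [folklore] -/ def e2 : Fin 4 →₀ ℕ := Finsupp.equivFunOnFinite.symm ![1, 1, 3, 1]
/-- exponent of `xyvw³`. [folklore] -/ def e3 : Fin 4 →₀ ℕ := Finsupp.equivFunOnFinite.symm ![1, 1, 1, 3]
/-- multiplicities `(1,1,1,1)`. [folklore] -/ def rA : Fin 4 →₀ ℕ := Finsupp.equivFunOnFinite.symm ![1, 1, 1, 1]
/-- `e1` coordinatewise. [folklore] -/ @[simp] theorem e1_apply (i : Fin 4) : e1 i = ![1, 3, 1, 1] i := rfl
/-- `e2` coordinatewise. [folklore] -/ @[simp] theorem e2_apply (i : Fin 4) : e2 i = ![1, 1, 3, 1] i := rfl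
/-- `e3` coordinatewise. [folklore] -/ @[simp] theorem e3_apply (i : Fin 4) : e3 i = ![1, 1, 1, 3] i := rfl
/-- `rA` coordinatewise. [folklore] -/ @[simp] theorem rA_apply (i : Fin 4) : rA i = ![1, 1, 1, 1] i := rfl

/-- exponents differing at one coordinate differ. [folklore] -/
private theorem ne_of_apply_ne' {d e : Fin 4 →₀ ℕ} (i : Fin 4) (h : d i ≠ e i) : d ≠ e :=
  fun hde => h (by rw [hde])
/-- the three exponents are pairwise distinct. [folklore] -/ theorem e1_ne_e2 : e1 ≠ e2 := ne_of_apply_ne' 1 (by simp)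
/-- see `e1_ne_e2`. [folklore] -/ theorem e1_ne_e3 : e1 ≠ e3 := ne_of_apply_ne' 1 (by simp)
/-- see `e1_ne_e2`. [folklore] -/ theorem e2_ne_e3 : e2 ≠ e3 := ne_of_apply_ne' 2 (by simp)

variable (K) in
/-- `F = xyvw·(y² + v² + w²) = xy³vw + xyv³w + xyvw³`. [folklore] -/
def FA : MvPolynomial (Fin 4) K := monomial e1 1 + monomial e2 1 + monomial e3 1

variable (K) in
/-- the parent state `a = (F, (1,1,1,1), all four hyperplanes exceptional)` (idea-2 P-2-1). [folklore] -/
def a : State K := ⟨FA K, rA, Finset.univ⟩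

/-- the `𝔽₄`-point `(y, v, w) = (1, ω, ω²)` of the `x`-chart: translation vector `(0, 1, ω, ω²)`. [folklore] -/
def b (ω : K) : Fin 4 → K := ![0, 1, ω, ω ^ 2]

/-- the kangaroo state: the model's step at `b ω` (no closed form is needed). [folklore] -/
def k [DecidableEq K] (ω : K) : State K := CentreBlowup.step 2 Finset.univ 0 (b ω) (a K)

/-! ### the parent: order `6`, shade `2` -/

/-- coefficient of `xy³vw` in `F`. [folklore] -/
theorem coeff_e1_FA : coeff e1 (FA K) = 1 := by
  rw [FA, coeff_add, coeff_add, coeff_monomial, coeff_monomial, coeff_monomial, if_pos rfl,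
    if_neg e1_ne_e2.symm, if_neg e1_ne_e3.symm, add_zero, add_zero]

/-- `supp F ⊆ {e1, e2, e3}`. [folklore] -/
theorem support_FA_subset : (FA K).support ⊆ {e1, e2, e3} := by
  intro d hd
  rw [FA] at hd
  simp only [Finset.mem_insert, Finset.mem_singleton]
  rcases Finset.mem_union.mp (support_add hd) with h | h
  · rcases Finset.mem_union.mp (support_add h) with h | h
    · exact Or.inl (Finset.mem_singleton.mp (support_monomial_subset h))
    · exact Or.inr (Or.inl (Finset.mem_singleton.mp (support_monomial_subset h)))
  · exact Or.inr (Or.inr (Finset.mem_singleton.mp (support_monomial_subset h)))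

/-- `ord₀ F = ord_{(x,y,v,w)} F = 6`. [folklore] -/
theorem ordAlong_univ_FA : ordAlong Finset.univ (FA K) = (6 : ℕ) := by
  apply le_antisymm
  · have := ordAlong_le_of_coeff_ne_zero (S := Finset.univ) (d := e1) (F := FA K)
      (by rw [coeff_e1_FA]; exact one_ne_zero)
    rw [degIn_univ, Finsupp.degree_eq_sum, Fin.sum_univ_four] at this; simpa using this
  · refine le_ordAlong_of_forall fun d hd => ?_
    have hd' := support_FA_subset hd
    simp only [Finset.mem_insert, Finset.mem_singleton] at hd'
    rcases hd' with rfl | rfl | rfl <;> simp [degIn_univ, Finsupp.degree_eq_sum, Fin.sum_univ_four]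

/-- shade `d = 6 − 4 = 2` at the parent. [folklore] -/
theorem shade_a : (a K).shade = 2 := by
  show ordZero (FA K) - (rA.degree : ℕ∞) = 2
  rw [← ordAlong_univ, ordAlong_univ_FA, Finsupp.degree_eq_sum, Fin.sum_univ_four]; simp; rfl

/-! ### the transform at the point `(1, ω, ω²)` of the `x`-chart -/

/-- the factor `U = x⁴(y+1)(v+ω)` (no `w`). [folklore] -/
def U (ω : K) : MvPolynomial (Fin 4) K := X 0 ^ 4 * (X 1 + 1) * (X 2 + C ω)
/-- the factor `V = (w + ω²)(y² + v² + w²)`. [folklore] -/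
def V (ω : K) : MvPolynomial (Fin 4) K := (X 3 + C ω ^ 2) * (X 1 ^ 2 + X 2 ^ 2 + X 3 ^ 2)
/-- `R⁺ = (y+1)(v+ω)(w+ω²) − 1`, of order `≥ 1` since `ω³ = 1`. [folklore] -/
def Rplus (ω : K) : MvPolynomial (Fin 4) K := (X 1 + 1) * (X 2 + C ω) * (X 3 + C ω ^ 2) - 1
/-- the square part `x⁴y² + x⁴v² + x⁴w²` that cleaning deletes. [folklore] -/
def Sq4 : MvPolynomial (Fin 4) K := X 0 ^ 4 * (X 1 ^ 2 + X 2 ^ 2 + X 3 ^ 2)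

/-- chart law: `|e| − 2 = 4` becomes the `x`-exponent. [folklore] -/
theorem chartExponent_e1 : chartExponent 2 Finset.univ 0 e1 = Finsupp.equivFunOnFinite.symm ![4, 3, 1, 1] := by
  rw [chartExponent_eq_iff, degIn_univ, Finsupp.degree_eq_sum, Fin.sum_univ_four]
  refine ⟨by simp, fun i hi => ?_⟩; fin_cases i <;> simp_all
/-- see `chartExponent_e1`. [folklore] -/
theorem chartExponent_e2 : chartExponent 2 Finset.univ 0 e2 = Finsupp.equivFunOnFinite.symm ![4, 1, 3, 1] := by
  rw [chartExponent_eq_iff, degIn_univ, Finsupp.degree_eq_sum, Fin.sum_univ_four]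
  refine ⟨by simp, fun i hi => ?_⟩; fin_cases i <;> simp_all
/-- see `chartExponent_e1`. [folklore] -/
theorem chartExponent_e3 : chartExponent 2 Finset.univ 0 e3 = Finsupp.equivFunOnFinite.symm ![4, 1, 1, 3] := by
  rw [chartExponent_eq_iff, degIn_univ, Finsupp.degree_eq_sum, Fin.sum_univ_four]
  refine ⟨by simp, fun i hi => ?_⟩; fin_cases i <;> simp_all

/-- the `x`-chart transform `x⁴yvw(y² + v² + w²)`. [folklore] -/
theorem chartTransform_FA : chartTransform 2 Finset.univ 0 (FA K) =
    X 0 ^ 4 * X 1 ^ 3 * X 2 * X 3 + X 0 ^ 4 * X 1 * X 2 ^ 3 * X 3 + X 0 ^ 4 * X 1 * X 2 * X 3 ^ 3 := by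
  rw [FA, chartTransform_add, chartTransform_add, chartTransform_monomial, chartTransform_monomial,
    chartTransform_monomial, chartExponent_e1, chartExponent_e2, chartExponent_e3, monomial_eq_prod,
    monomial_eq_prod, monomial_eq_prod]
  simp

/-- **The transform at `(1, ω, ω²)`** (before cleaning) is `U·V = x⁴(y+1)(v+ω)(w+ω²)(y²+v²+w²)`:
the constant `1 + ω² + ω⁴ = (ω²+ω+1)(ω²−ω+1)` and the cross terms `2(…)` vanish. [folklore] -/
theorem pointTransform_a [CharP K 2] (ω : K) (hω : ω ^ 2 + ω + 1 = 0) :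
    pointTransform 2 Finset.univ 0 (b ω) (a K) = U ω * V ω := by
  have h2 : (2 : MvPolynomial (Fin 4) K) = 0 := by
    have := CharP.cast_eq_zero (MvPolynomial (Fin 4) K) 2
    exact_mod_cast this
  have hω' : (C ω : MvPolynomial (Fin 4) K) ^ 2 + C ω + 1 = 0 := by
    have := congrArg (C : K → MvPolynomial (Fin 4) K) hω
    simpa using this
  rw [pointTransform, show (a K).F = FA K from rfl, chartTransform_FA]
  simp only [PointBlowup.translate, map_add, map_mul, map_pow, aeval_X, b, Matrix.cons_val_zero,
    Matrix.cons_val_one, Matrix.cons_val, map_one, map_zero, add_zero, U, V]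
  linear_combination (X 0 ^ 4 * (X 1 + 1) * (X 2 + C ω) * (X 3 + C ω ^ 2) *
      (X 1 + C ω * X 2 + C ω ^ 2 * X 3)) * h2 +
    (X 0 ^ 4 * (X 1 + 1) * (X 2 + C ω) * (X 3 + C ω ^ 2) * (C ω ^ 2 - C ω + 1)) * hω'

/-- `U·V = x⁴·R⁺·(y²+v²+w²) + (x⁴y² + x⁴v² + x⁴w²)`. [folklore] -/
theorem U_mul_V (ω : K) : U ω * V ω = X 0 ^ 4 * Rplus ω * (X 1 ^ 2 + X 2 ^ 2 + X 3 ^ 2) + Sq4 := by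
  simp only [U, V, Rplus, Sq4]; ring

/-- cleaning deletes the three squares `x⁴y², x⁴v², x⁴w²`. [folklore] -/
theorem deletePthPowers_Sq4 : deletePthPowers 2 (Sq4 : MvPolynomial (Fin 4) K) = 0 := by
  classical
  have hsq : ∀ v : Fin 4 → ℕ, (∀ i, 2 ∣ v i) →
      deletePthPowers 2 (monomial (Finsupp.equivFunOnFinite.symm v) (1 : K)) = 0 := fun v hv => by
    rw [deletePthPowers_monomial, if_pos ((isPthPowerExponent_iff 2 _).mpr fun i => by simpa using hv i)]
  have e : (Sq4 : MvPolynomial (Fin 4) K) = monomial (Finsupp.equivFunOnFinite.symm ![4, 2, 0, 0]) 1 +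
      monomial (Finsupp.equivFunOnFinite.symm ![4, 0, 2, 0]) 1 +
      monomial (Finsupp.equivFunOnFinite.symm ![4, 0, 0, 2]) 1 := by
    rw [monomial_eq_prod, monomial_eq_prod, monomial_eq_prod, Sq4]; simp; ring
  rw [e, deletePthPowers_add, deletePthPowers_add,
    hsq _ (fun i => by fin_cases i <;> simp), hsq _ (fun i => by fin_cases i <;> simp),
    hsq _ (fun i => by fin_cases i <;> simp), add_zero, add_zero]

/-- `R⁺(0) = ω³ − 1 = 0`, so `ord₀ R⁺ ≥ 1`. [folklore] -/
theorem one_le_ordZero_Rplus (ω : K) (hω : ω ^ 2 + ω + 1 = 0) : 1 ≤ ordZero (Rplus ω) := by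
  rw [one_le_ordZero_iff]
  simp only [Rplus, map_sub, map_mul, map_add, map_pow, constantCoeff_X, constantCoeff_C, map_one]
  linear_combination (ω - 1) * hω

/-- `ord₀ (y² + v² + w²) ≥ 2`. [folklore] -/
theorem two_le_ordZero_sq : (2 : ℕ∞) ≤ ordZero (X 1 ^ 2 + X 2 ^ 2 + X 3 ^ 2 : MvPolynomial (Fin 4) K) := by
  refine le_ordZero_add (le_ordZero_add ?_ ?_) ?_ <;> rw [ordZero_X_pow] <;> exact le_rfl

/-- **The cleaned transform has order `≥ 7`**: `4 + 1 + 2`. [folklore] -/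
theorem seven_le_ordZero_clean (ω : K) (hω : ω ^ 2 + ω + 1 = 0) :
    (7 : ℕ∞) ≤ ordZero (deletePthPowers 2 (U ω * V ω)) := by
  classical
  rw [U_mul_V, deletePthPowers_add, deletePthPowers_Sq4, add_zero]
  refine le_trans ?_ (le_ordZero_deletePthPowers 2 _)
  calc (7 : ℕ∞) = 4 + 1 + 2 := by norm_num
    _ ≤ ordZero (X 0 ^ 4 : MvPolynomial (Fin 4) K) + ordZero (Rplus ω) +
          ordZero (X 1 ^ 2 + X 2 ^ 2 + X 3 ^ 2 : MvPolynomial (Fin 4) K) := by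
        rw [ordZero_X_pow]
        exact add_le_add (add_le_add le_rfl (one_le_ordZero_Rplus ω hω)) two_le_ordZero_sq
    _ ≤ ordZero (X 0 ^ 4 * Rplus ω * (X 1 ^ 2 + X 2 ^ 2 + X 3 ^ 2)) :=
        le_trans (add_le_add (le_ordZero_mul _ _) le_rfl) (le_ordZero_mul _ _)

/-- `∂_w (U·V)` evaluated at `(x,y,v,w) = (1,0,1,0)` is `1 + ω`. [folklore] -/
theorem eval_pderiv_U_mul_V (ω : K) :
    eval ![(1 : K), 0, 1, 0] (pderiv 3 (U ω * V ω)) = 1 + ω := by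
  simp only [U, V, pderiv_mul, Derivation.leibniz_pow, pderiv_X, map_add, map_mul, map_pow, map_one,
    pderiv_C, eval_X, eval_C, Matrix.cons_val_zero, Matrix.cons_val_one, Matrix.cons_val,
    Pi.single_apply]
  simp

/-- **The cleaned transform is non-zero**: its `∂_w` is that of `U·V` (characteristic 2), whose value
at `(1,0,1,0)` is `1 + ω ≠ 0` (else `ω = −1` and `ω² + ω + 1 = 1`). [folklore] -/
theorem clean_ne_zero [CharP K 2] (ω : K) (hω : ω ^ 2 + ω + 1 = 0) :
    deletePthPowers 2 (U ω * V ω) ≠ 0 := by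
  intro h
  have h1 : pderiv 3 (U ω * V ω) = 0 := by rw [← pderiv_deletePthPowers 2 3, h, map_zero]
  have h2 : (1 : K) + ω = 0 := by rw [← eval_pderiv_U_mul_V ω, h1, map_zero]
  have h3 : ω = -1 := by linear_combination h2
  rw [h3] at hω
  norm_num at hω

/-! ### the edge and the rise -/

/-- `ω ≠ 0`. [folklore] -/
theorem omega_ne_zero (ω : K) (hω : ω ^ 2 + ω + 1 = 0) : ω ≠ 0 := by
  rintro rfl; norm_num at hω

/-- the new multiplicities: `y, v, w` are lost (`b ≠ 0` there), `x` gets `6 − 2 = 4`. [folklore] -/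
theorem newMult_a [DecidableEq K] (ω : K) (hω : ω ^ 2 + ω + 1 = 0) :
    newMult 2 Finset.univ 0 (b ω) (a K) = Finsupp.single 0 4 := by
  have h0 := omega_ne_zero ω hω
  unfold newMult
  rw [show (a K).r = rA from rfl, show (a K).F = FA K from rfl, ordAlong_univ_FA, ENat.toNat_coe]
  ext i
  rw [Finsupp.update_apply, Finsupp.filter_apply, Finsupp.single_apply]
  fin_cases i <;> simp [b, h0]

/-- the point `(1, ω, ω²)` is again a `2`-fold point: `U·V` has order `≥ 4`. [folklore] -/
theorem isEquimultiplePoint_a [CharP K 2] [DecidableEq K] (ω : K) (hω : ω ^ 2 + ω + 1 = 0) :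
    IsEquimultiplePoint 2 Finset.univ 0 (b ω) (a K) := by
  intro d _ hd
  rw [pointTransform_a ω hω]
  apply coeff_eq_zero_of_degree_lt_ordZero
  have h4 : (4 : ℕ∞) ≤ ordZero (U ω * V ω) := by
    refine le_trans ?_ (le_ordZero_mul_right _ _)
    refine le_trans ?_ (le_ordZero_mul_right _ _)
    refine le_trans ?_ (le_ordZero_mul_right _ _)
    rw [ordZero_X_pow]; exact_mod_cast le_rfl
  exact lt_of_lt_of_le (by exact_mod_cast (by omega : d.degree < 4)) h4

/-- **The edge of row J-001**: `a ⟶ k ω` above the point centre, `x`-chart, point `(1, ω, ω²)`. [folklore] -/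
theorem edge_a_k [CharP K 2] [DecidableEq K] (ω : K) (hω : ω ^ 2 + ω + 1 = 0) :
    Edge 2 Finset.univ (a K) (k ω) := by
  refine ⟨0, b ω, Finset.mem_univ _, rfl, isEquimultiplePoint_a ω hω, ?_, rfl⟩
  show deletePthPowers 2 (pointTransform 2 Finset.univ 0 (b ω) (a K)) ≠ 0
  rw [pointTransform_a ω hω]; exact clean_ne_zero ω hω

/-- it is a MODE-0 (point) step. [folklore] -/
theorem step0_a_k [CharP K 2] [DecidableEq K] (ω : K) (hω : ω ^ 2 + ω + 1 = 0) :
    Step0 2 (a K) (k ω) :=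
  ⟨by rw [show (a K).F = FA K from rfl, ordAlong_univ_FA]; exact_mod_cast (by norm_num : (2 : ℕ) ≤ 6),
    edge_a_k ω hω⟩

/-- **RISE:d `2 → ≥ 3`** (in fact `= 3`, Moh's bound; `≥` suffices for the flag). [folklore] -/
theorem riseD_a_k [CharP K 2] [DecidableEq K] (ω : K) (hω : ω ^ 2 + ω + 1 = 0) :
    RiseD (a K) (k ω) := by
  show (a K).shade < (k ω).shade
  rw [shade_a]
  show (2 : ℕ∞) < ordZero (deletePthPowers 2 (pointTransform 2 Finset.univ 0 (b ω) (a K))) -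
    ((newMult 2 Finset.univ 0 (b ω) (a K)).degree : ℕ∞)
  rw [pointTransform_a ω hω, newMult_a ω hω, Finsupp.degree_single]
  have h7 := seven_le_ordZero_clean ω hω
  have h3 : ∀ o : ℕ∞, (7 : ℕ∞) ≤ o → (3 : ℕ∞) ≤ o - 4 := by
    intro o ho
    induction o using ENat.recTopCoe with
    | top => simp
    | coe n =>
      have hn : 7 ≤ n := by exact_mod_cast ho
      rw [show (4 : ℕ∞) = ((4 : ℕ) : ℕ∞) from rfl, ← ENat.coe_sub]
      exact_mod_cast (by omega : 3 ≤ n - 4)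
  exact lt_of_lt_of_le (by norm_num) (h3 _ h7)

end AnyField

/-! ### instantiation in `𝔽₄ = GaloisField 2 2` -/

/-- `𝔽₄` contains a primitive cube root of unity. [folklore] -/
theorem exists_omega_galoisField : ∃ ω : GaloisField 2 2, ω ^ 2 + ω + 1 = 0 := by
  classical
  haveI : Fintype (GaloisField 2 2) := Fintype.ofFinite _
  have hcard : Fintype.card (GaloisField 2 2) = 4 := by
    rw [← Nat.card_eq_fintype_card, GaloisField.card 2 2 two_ne_zero]; norm_num
  obtain ⟨ω, -, hω⟩ : ∃ ω, ω ∈ (Finset.univ : Finset (GaloisField 2 2)) ∧ ω ∉ ({0, 1} : Finset _) :=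
    Finset.exists_mem_notMem_of_card_lt_card (by
      rw [Finset.card_univ, hcard]; exact lt_of_le_of_lt (Finset.card_le_two) (by norm_num))
  simp only [Finset.mem_insert, Finset.mem_singleton, not_or] at hω
  have h4 : ω ^ 4 = ω := by rw [← hcard]; exact FiniteField.pow_card ω
  refine ⟨ω, ?_⟩
  have : ω * (ω - 1) * (ω ^ 2 + ω + 1) = 0 := by linear_combination h4
  rcases mul_eq_zero.mp this with h | h
  · rcases mul_eq_zero.mp h with h | h
    · exact absurd h hω.1
    · exact absurd (sub_eq_zero.mp h) hω.2
  · exact h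

end J001

end ZooCert

open ZooCert J001 in
/-- **J-001 over any field of characteristic 2 with a primitive cube root of unity `ω`**: the POINT
blow-up of `xyvw(y² + v² + w²)` (all four hyperplanes exceptional, shade 2) has at the point
`(1, ω, ω²)` of the `x`-chart an equimultiple point of shade `≥ 3`. [folklore] -/
theorem exists_step0_riseD_of_cube_root (K : Type) [Field K] [CharP K 2] [DecidableEq K] (ω : K)
    (hω : ω ^ 2 + ω + 1 = 0) : ∃ s s' : State K, Step0 2 s s' ∧ RiseD s s' :=
  ⟨a K, k ω, step0_a_k ω hω, riseD_a_k ω hω⟩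

open scoped Classical in
open ZooCert J001 in
/-- **J-001 ‖ K.**  In class (4,1) at `p = 2` the POINT blow-up of `xyvw(y² + v² + w²)` (all four
hyperplanes exceptional, shade 2) has, at the `𝔽₄`-point `(1, ω, ω²)` of the `x`-chart, an
equimultiple point with shade `≥ 3` — the IRRATIONAL kangaroo of idea-2's P-2-1 / JUMPS J-001
(K = B; KNOWN-INSTANCE: Hauser–Perlega's theorem with `b = 4` lost components).  Census value
only; nothing about resolution of singularities. [folklore] -/
theorem exists_step0_riseD_galoisField_two_two :
    ∃ s s' : State (GaloisField 2 2), Step0 2 s s' ∧ RiseD s s' := by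
  obtain ⟨ω, hω⟩ := exists_omega_galoisField
  exact exists_step0_riseD_of_cube_root _ ω hω

end Summit.ResolutionOfSingularities.ResolutionOfSingularities.Theorems.PIDim4

end
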